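import Literature.Probability.Percolation.Z2PivotalMeasure
import Literature.Probability.Percolation.ZdFourArmPositivity

/-!
# Crux `FlipErgodicityZ2` (stmt-CriticalPhenomena-14825), line `registered`, stub
# `stub_latticeSecondMoment`: the reference edge four-arm event has positive probability

Route `Summits/CriticalPhenomena/CardyFormulaZ2/Theses/CardyMeckeFlip`.  Helper file (supports the
crux item) for the uniform second-moment bound of the Garban–Pete–Schramm pivotal measures of
bond-`ℤ²` (`stub_latticeSecondMoment`).  The normalisation `r(δ) = δ² / α₄(δ,1)` of the pivotal
measures divides by the probability of the cluster-form event `edgeFourArm [-N,N]² 0 0` ("four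
alternating arms from the edge `s(0, e₀)` to `∂[-N,N]²`", `Z2PivotalMeasure.lean`) at
`N = ⌊1/δ⌋`; the quasi-multiplicativity input of the second-moment computation compares it with
the same probability at a fixed radius `N₀`, which must therefore be shown to be POSITIVE:

* `mem_edgeFourArm_box_of_axis` — the lattice configuration "horizontal axis of `[-N,N]²` open
  except the edge `s(0, e₀)` itself, everything else in the box closed" has four arms from
  `s(0, e₀)` to `∂[-N,N]²` (`e₀ ↔ (N,0)`, `0 ↔ (-N,0)`, and an open path from `0` keeps a
  non-positive first coordinate);
* `real_edgeFourArm_box_pos` — hence `P_{1/2}(edgeFourArm [-N,N]² 0 0) > 0` for `N ≥ 1`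
  (a cylinder event of positive probability, as in the tree's `real_fourArmTwoClusters_pos`).
-/

noncomputable section

open MeasureTheory Set
open Literature.Probability.Percolation Literature.Probability.LatticeModels

namespace Summit.CriticalPhenomena.CardyFormulaZ2.Theorems.CardyMeckeFlip

/-! ### The reference event has positive probability -/

/-- `(i, 0) ∈ [-N,N]²` for `|i| ≤ N`. [folklore] -/
theorem pt_zero_mem_box {N : ℕ} {i : ℤ} (hi : |i| ≤ N) : pt i 0 ∈ box 2 N := by
  rw [mem_box]
  intro k
  fin_cases k
  · simpa using abs_le.1 hi
  · simp

/-- The site `(N, 0)` lies on the vertex boundary of `[-N,N]²`. [folklore] -/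
theorem pt_pos_mem_vertexBoundary_box (N : ℕ) :
    pt N 0 ∈ vertexBoundary (↑(box 2 N) : Set (Site 2)) := by
  refine ⟨Finset.mem_coe.2 (pt_zero_mem_box (by simp)), pt ((N : ℤ) + 1) 0, ?_, ?_⟩
  · simp only [Finset.mem_coe, mem_box, not_forall]
    exact ⟨0, by simp⟩
  · rw [zdGraph_adj_iff]
    exact ⟨0, Or.inl (pt_succ_eq (N : ℤ) 0)⟩

/-- The site `(-N, 0)` lies on the vertex boundary of `[-N,N]²`. [folklore] -/
theorem pt_neg_mem_vertexBoundary_box (N : ℕ) :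
    pt (-(N : ℤ)) 0 ∈ vertexBoundary (↑(box 2 N) : Set (Site 2)) := by
  refine ⟨Finset.mem_coe.2 (pt_zero_mem_box (by simp)), pt (-(N : ℤ) - 1) 0, ?_, ?_⟩
  · simp only [Finset.mem_coe, mem_box, not_forall]
    exact ⟨0, by simp⟩
  · rw [zdGraph_adj_iff]
    refine ⟨0, Or.inr ?_⟩
    have := pt_succ_eq (-(N : ℤ) - 1) 0
    rwa [sub_add_cancel] at this

/-- **The configuration "horizontal axis of `[-N,N]²` open except `s(0, e₀)`" has four arms from
`s(0, e₀)` to `∂[-N,N]²`** (`N ≥ 1`, lattice configuration): `e₀ = (1,0)` is joined to `(N, 0)`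
along the positive axis, `0` to `(-N, 0)` along the negative axis, and an open path from `0`
never reaches a site with positive first coordinate. [folklore] -/
theorem mem_edgeFourArm_box_of_axis {N : ℕ} (hN : 1 ≤ N) {ω : BondConfig (Site 2)}
    (hω : ω ⊆ (zdGraph 2).edgeSet)
    (hpos : (↑(posAxisEdges 1 N) : Set (Sym2 (Site 2))) ⊆ ω)
    (hneg : (↑(negAxisEdges 0 N) : Set (Sym2 (Site 2))) ⊆ ω)
    (hclosed : ∀ e ∈ (box 2 N).sym2, e ∈ ω → e ∈ posAxisEdges 1 N ∪ negAxisEdges 0 N) :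
    ω ∈ edgeFourArm (↑(box 2 N) : Set (Site 2)) 0 0 := by
  have h00 : (0 : Site 2) = pt 0 0 := by ext k; fin_cases k <;> simp
  have h10 : (0 : Site 2) + Pi.single 0 1 = pt 1 0 := by ext k; fin_cases k <;> simp
  -- the edge itself is closed, so deleting it does nothing
  have he0 : edgeFrom (0 : Site 2) 0 = s(pt 0 0, pt 1 0) := by
    show s((0 : Site 2), (0 : Site 2) + Pi.single 0 1) = s(pt 0 0, pt 1 0)
    rw [h10, h00]
  have he0box : edgeFrom (0 : Site 2) 0 ∈ (box 2 N).sym2 := by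
    rw [he0, Finset.mk_mem_sym2_iff]
    exact ⟨pt_zero_mem_box (by simp), pt_zero_mem_box (by simp; exact_mod_cast hN)⟩
  have he0ω : edgeFrom (0 : Site 2) 0 ∉ ω := fun h => by
    have := hclosed _ he0box h
    rw [he0, Finset.mem_union] at this
    rcases this with h' | h'
    · simp only [posAxisEdges, Finset.mem_image, Finset.mem_Ico] at h'
      obtain ⟨i, ⟨hi1, -⟩, hi⟩ := h'
      rcases Sym2.eq_iff.1 hi with ⟨h3, -⟩ | ⟨-, h3⟩
      · have := congrFun h3 0; simp at this; omega
      · have := congrFun h3 0; simp at this; omega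
    · simp only [negAxisEdges, Finset.mem_image, Finset.mem_Ico] at h'
      obtain ⟨i, ⟨-, -⟩, hi⟩ := h'
      rcases Sym2.eq_iff.1 hi with ⟨-, h3⟩ | ⟨h3, -⟩
      · have := congrFun h3 0; simp at this; omega
      · have := congrFun h3 0; simp at this; omega
  have hsd : ω \ {edgeFrom (0 : Site 2) 0} = ω := sdiff_singleton_eq_self he0ω
  rw [edgeFourArm, mem_setOf_eq, hsd]
  -- the two arms
  obtain ⟨p₁, hp₁s, hp₁e⟩ := exists_posAxis_walk 1 (N - 1)
  obtain ⟨p₂, hp₂s, hp₂e⟩ := exists_negAxis_walk 0 N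
  have hN1 : (1 : ℤ) + ((N - 1 : ℕ) : ℤ) = N := by push_cast [Nat.cast_sub hN]; ring
  have harm₁ : ω ∈ openConnIn (↑(box 2 N) : Set (Site 2)) (pt 1 0) (pt N 0) := by
    have := mem_openConnIn_of_walk (S := (↑(box 2 N) : Set (Site 2))) (ω := ω) p₁
      (fun z hz => ?_) (fun e he => ?_)
    · simp only [Nat.cast_one] at this
      rwa [hN1] at this
    · obtain ⟨j, hj, rfl⟩ := hp₁s z hz
      exact Finset.mem_coe.2 (pt_zero_mem_box
        (by rw [abs_of_nonneg (by positivity)]; push_cast; omega))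
    · obtain ⟨j, hj, rfl⟩ := hp₁e e he
      apply hpos
      simp only [posAxisEdges, Finset.coe_image, Finset.coe_Ico, Set.mem_image, Set.mem_Ico]
      exact ⟨1 + j, ⟨by omega, by omega⟩, by push_cast; ring_nf⟩
  have harm₂ : ω ∈ openConnIn (↑(box 2 N) : Set (Site 2)) (pt 0 0) (pt (-(N : ℤ)) 0) := by
    have := mem_openConnIn_of_walk (S := (↑(box 2 N) : Set (Site 2))) (ω := ω) p₂
      (fun z hz => ?_) (fun e he => ?_)
    · simpa only [Nat.cast_zero, neg_zero, zero_add] using this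
    · obtain ⟨j, hj, rfl⟩ := hp₂s z hz
      exact Finset.mem_coe.2 (pt_zero_mem_box
        (by rw [abs_of_nonpos (by push_cast; omega)]; push_cast; omega))
    · obtain ⟨j, hj, rfl⟩ := hp₂e e he
      apply hneg
      simp only [negAxisEdges, Finset.coe_image, Finset.coe_Ico, Set.mem_image, Set.mem_Ico]
      exact ⟨j, ⟨by omega, by omega⟩, by push_cast; ring_nf⟩
  refine ⟨⟨pt (-(N : ℤ)) 0, pt_neg_mem_vertexBoundary_box N, by rw [h00]; exact harm₂⟩,
    ⟨pt N 0, pt_pos_mem_vertexBoundary_box N, by rw [h10]; exact harm₁⟩, fun hconn => ?_⟩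
  -- non-connection: an open path from `0` keeps a non-positive first coordinate
  obtain ⟨q, hqs, hqe⟩ := exists_walk_of_mem_openConnIn hω hconn
  have key : ∀ v ∈ q.support, v 0 ≤ 0 := by
    suffices H : ∀ (u w : Site 2) (q' : (zdGraph 2).Walk u w), u 0 ≤ 0 →
        (∀ z ∈ q'.support, z ∈ (↑(box 2 N) : Set (Site 2))) → (∀ e ∈ q'.edges, e ∈ ω) →
        ∀ v ∈ q'.support, v 0 ≤ 0 from H _ _ q (by simp) hqs hqe
    intro u w q'
    induction q' with
    | nil =>
      intro hu _ _ v hv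
      rw [SimpleGraph.Walk.support_nil, List.mem_singleton] at hv
      rw [hv]; exact hu
    | @cons a b c hab q'' ih =>
      intro ha hs he v hv
      rw [SimpleGraph.Walk.support_cons, List.mem_cons] at hv
      rcases hv with rfl | hv
      · exact ha
      · have hab_ω : s(a, b) ∈ ω := he _ (by simp)
        have hmem : s(a, b) ∈ (box 2 N).sym2 := by
          rw [Finset.mk_mem_sym2_iff]
          exact ⟨Finset.mem_coe.1 (hs a (by simp)), Finset.mem_coe.1 (hs b (by simp))⟩
        have hb0 : b 0 ≤ 0 := by
          have h' := hclosed _ hmem hab_ω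
          rw [Finset.mem_union] at h'
          rcases h' with h' | h'
          · exfalso
            simp only [posAxisEdges, Finset.mem_image, Finset.mem_Ico] at h'
            obtain ⟨i, ⟨hi1, -⟩, hi⟩ := h'
            rcases Sym2.eq_iff.1 hi with ⟨h3, -⟩ | ⟨-, h3⟩
            · have := congrFun h3 0; simp at this; omega
            · have := congrFun h3 0; simp at this; omega
          · simp only [negAxisEdges, Finset.mem_image, Finset.mem_Ico] at h'
            obtain ⟨i, ⟨-, -⟩, hi⟩ := h'
            rcases Sym2.eq_iff.1 hi with ⟨-, h3⟩ | ⟨h3, -⟩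
            · have := congrFun h3 0; simp at this; omega
            · have := congrFun h3 0; simp at this; omega
        exact ih hb0 (fun z hz => hs z (by simp [hz])) (fun e he' => he e (by simp [he'])) v hv
  have := key _ q.end_mem_support
  simp at this

/-- **The reference edge four-arm event has positive probability**:
`P_{1/2}(edgeFourArm [-N,N]² 0 0) > 0` for every `N ≥ 1` (the cylinder event "positive and
negative axis edges open, all other pairs of the box closed" realises it). [folklore] -/
theorem real_edgeFourArm_box_pos :
    ∀ N : ℕ, 1 ≤ N →
      0 < (bondPercolation (zdGraph 2) half).real (edgeFourArm (↑(box 2 N) : Set (Site 2)) 0 0) := by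
  intro N hN
  classical
  set P := bondPercolation (zdGraph 2) half with hP
  set Fo : Finset (Sym2 (Site 2)) := posAxisEdges 1 N ∪ negAxisEdges 0 N with hFo
  set Fc : Finset (Sym2 (Site 2)) := ((box 2 N).sym2).filter fun e => e ∉ Fo with hFc
  set A : Set (BondConfig (Site 2)) := {ω | (↑Fo : Set (Sym2 (Site 2))) ⊆ ω} with hA
  set B : Set (BondConfig (Site 2)) := {ω | ∀ e ∈ Fc, e ∉ ω} with hB
  have hFoE : (↑Fo : Set (Sym2 (Site 2))) ⊆ (zdGraph 2).edgeSet := by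
    rw [hFo, Finset.coe_union]
    exact union_subset (posAxisEdges_subset_edgeSet 1 N) (negAxisEdges_subset_edgeSet 0 N)
  have hdisj : Disjoint (↑Fo : Set (Sym2 (Site 2))) ↑Fc := by
    rw [Set.disjoint_left]
    intro e heo hec
    rw [Finset.mem_coe, hFc, Finset.mem_filter] at hec
    exact hec.2 heo
  have hincl : ∀ ω : BondConfig (Site 2), ω ⊆ (zdGraph 2).edgeSet → ω ∈ A ∩ B →
      ω ∈ edgeFourArm (↑(box 2 N) : Set (Site 2)) 0 0 := by
    rintro ω hω ⟨hA', hB'⟩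
    refine mem_edgeFourArm_box_of_axis hN hω
      ((Finset.coe_subset.2 Finset.subset_union_left).trans hA')
      ((Finset.coe_subset.2 Finset.subset_union_right).trans hA') fun e he heω => ?_
    by_contra hnot
    exact hB' e (by rw [hFc, Finset.mem_filter]; exact ⟨he, hnot⟩) heω
  have hAB : P.real (A ∩ B) = P.real A * P.real B :=
    bondPercolation_real_inter_of_disjoint (zdGraph 2) half hdisj (determinedBy_setOf_subset _)
      (determinedBy_forall_notMem Fc) (measurableSet_setOf_subset (Finset.countable_toSet _))
      (measurableSet_forall_notMem Fc)
  have hApos : 0 < P.real A := by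
    rw [hA, bondPercolation_real_setOf_subset _ half Fo hFoE]
    exact pow_pos (by rw [coe_half]; norm_num) _
  have hBpos : 0 < P.real B := by
    refine lt_of_lt_of_le (pow_pos ?_ _) (le_bondPercolation_real_forall_notMem (zdGraph 2) half Fc)
    rw [coe_half]; norm_num
  have hae : (A ∩ B : Set (BondConfig (Site 2))) ≤ᵐ[P]
      (edgeFourArm (↑(box 2 N) : Set (Site 2)) 0 0 : Set (BondConfig (Site 2))) :=
    (ae_subset_edgeSet (zdGraph 2) half).mono fun ω hω h => hincl ω hω h
  calc 0 < P.real A * P.real B := mul_pos hApos hBpos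
    _ = P.real (A ∩ B) := hAB.symm
    _ ≤ P.real (edgeFourArm (↑(box 2 N) : Set (Site 2)) 0 0) :=
        ENNReal.toReal_mono (measure_ne_top _ _) (measure_mono_ae hae)

end Summit.CriticalPhenomena.CardyFormulaZ2.Theorems.CardyMeckeFlip

end
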